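import Summits.QuantumFields.YangMills.Theorems.UnitScaleTiltBlockAvgCorrector
import Summits.QuantumFields.YangMills.Theorems.UnitScaleTiltSmoothLiftRough
import Literature.MathematicalPhysics.QuantumFieldTheory.Balaban1983to89.T3OneStepAveragingPlaquettes
import HarnessLib

/-!
# Route `UnitScaleTilt` (rung R3), crux K1 child «MinimiserStabilityRegPr» (stmt-QuantumFields-19200), stub `stub_smoothLift` (G-K1a-2′):
# EXACTNESS IS FREE — `SmoothLiftAt` FOLLOWS FROM AN APPROXIMATE SMOOTH LIFT (block average within `C₃(b + a²)` of the datum bond by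
# bond) by the exact corrector of `UnitScaleTiltBlockAvgCorrector`, with the three estimates of the schema preserved

Cell `ym3-torus` (HUMAN RULING D-0037, YM ladder rung R3), seat `ym3-torus-p1` gen 9 (UV side); cell record HOME/UV3-NODE.md §18.  WHAT THIS IS
NOT: no lift is constructed here and nothing of Bałaban's is asserted; the approximate smooth lift is a HYPOTHESIS (the located content of
G-K1a-2′ after this file, spelled out in the theorem's statement), and the theorem is the kernel-checked reduction of the registered stub's
schema `T3UpperLiftSplit.SmoothLiftAt` to it.

THE POINT.  `SmoothLiftAt L C₁ C₂ c` asks, for a field `U` on the finest lattice of run `K` with plaquettes `< a` and curvature gradients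
`≤ b`, for `U″` one level up with (i) `D_{K,K+1}U″ = U` EXACTLY, (ii) plaquettes `< C₁(a+b)`, (iii) gradients `≤ C₁(b + a²)`, (iv) `L·A(U″) ≤
A(U) + C₂(b² + ab + a³)L^{3(m+K)}`.  Clause (i) is what makes the intended witness (smooth interpolation, [Balaban1985Averaging] Props 3–4 /
[King1986] (A.5)) awkward: the interpolated field averages back to `U` only approximately.  **`smoothLiftAt_of_approx`**: it suffices to
produce `U″` with (ii)–(iv) and (i′) `‖(D_{K,K+1}U″)(c) − U(c)‖ ≤ C₃(b + a²)` for every coarse bond `c` — the APPROXIMATE SMOOTH LIFT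
hypothesis, spelled out in the theorem (no schema is defined here) — because the exact corrector (`BlockAvgCorrector.exists_corrector_T3`: radius `t₀(L)`, cost `C(L) = 72L³` per unit defect)
then moves the central bonds of `U″` by `≤ C·C₃(b + a²)`, which (§1) moves every plaquette by `≤ 4CC₃(b + a²)` (`BlockAvgCorrector.
norm_plaqHol_sub_plaqHol_le`), every curvature gradient by `≤ 10CC₃(b + a²)` (`norm_covDerivT_plaqFT_sub_le`: the [Balaban1985RegularSpaces]
(1.1) reading `V(z,ν)⁻¹V(∂p(z))V(z,ν) − V(∂p(z+e_ν))` of the gradient, dictionary of `UnitScaleTiltMinimiserStabilityRegPrAvgCurvGrad` §1,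
is 10-Lipschitz in the bonds), and the Wilson action by `≤ ½Σ_p |d′² − d²| ≤ 24L^{3(m+K+1)}·4CC₃(b + a²)·(2C₁(a+b) + 4CC₃(b + a²))` (SU(2):
`1 − Re tr W = ½|W − 1|²`), a polynomial in `a, b` with every monomial inside `b² + ab + a³` for `a ≤ 1` — so (ii)–(iv) survive with
`C₁′ = C₁ + 10CC₃`, `C₂′ = C₂ + 384·L⁴·CC₃(C₁ + CC₃)`, `c′ = min c (min 1 (t₀/(2C₁ + 2CC₃ + 1)))`.  Together with `SmoothLift.smoothLiftAt_of_smooth`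
(the rough regime `a ≤ b` is the face section) the located content of `stub_smoothLift` is: an APPROXIMATE smooth lift in the smooth regime.

References: T. Bałaban, CMP 98 (1985) 17–51 [Balaban1985Averaging] (Props 3–4, (122)–(125) p.36); CMP 99 (1985) 75–102
[Balaban1985RegularSpaces] ((1.1) p.76); CMP 109 (1987) 249–301 [Balaban1987RG1] ((0.2), (0.4) p.252–253); C. King, CMP 102 (1986) 649–677
[King1986] ((A.5) p.676).
-/

noncomputable section

open scoped BigOperators Matrix.Norms.L2Operator

namespace Summit.QuantumFields.YangMills.Theorems.SmoothLiftApprox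

open Literature.MathematicalPhysics.QuantumFieldTheory.Balaban1983to89
open T4Continuum BlockAveraging AveragingRT ExpMeanLog
open B10Eq27TorusAxialLog (toUField unitsField)
open B10Eq68TorusRegularity (plaqFT covDerivT)
open T3ContinuumYM3Torus T3LevelShift T3TiltDescent T3UpperLiftSplit
open T3UnitLawDensityEML (ℰp)
open T3OneStepAveragingPlaquettes (descendTo_succ)
open Summit.QuantumFields.YangMills.Theorems.AvgCurvGrad (covDerivT_plaqFT_shift_eq covDerivT_plaqFT_shift_eq_inv shift_unshift')
open Summit.QuantumFields.YangMills.Theorems.AvgActionDefect (one_sub_reTr_eq_half_dist1_sq_su2)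
open Summit.QuantumFields.YangMills.Theorems.BlockAvgCorrector (norm_plaqHol_sub_plaqHol_le plaqSmall_of_forall_norm_sub_le exists_corrector_T3)

/-! ## §0 `SU(2)` read in `M₂(ℂ)` (local one-liners) -/

section Matrices

variable {n : Type*} [Fintype n] [DecidableEq n]

/-- A special unitary matrix has operator norm `1`. [folklore] -/
private theorem norm_coe_su [Nonempty n] (g : Matrix.specialUnitaryGroup n ℂ) : ‖(g : Matrix n n ℂ)‖ = 1 :=
  UnitaryModel.norm_of_mem_unitaryGroup (Matrix.specialUnitaryGroup_le_unitaryGroup g.2)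

/-- The inverse in `SU(N)` is the adjoint. [folklore] -/
private theorem coe_inv_su (g : Matrix.specialUnitaryGroup n ℂ) :
    ((g⁻¹ : Matrix.specialUnitaryGroup n ℂ) : Matrix n n ℂ) = star (g : Matrix n n ℂ) := rfl

/-- `‖g₁g₂ − h₁h₂‖ ≤ ‖g₁ − h₁‖ + ‖g₂ − h₂‖` for special unitaries. [folklore] -/
private theorem norm_coe_mul_sub_mul_le [Nonempty n] (g₁ g₂ h₁ h₂ : Matrix.specialUnitaryGroup n ℂ) :
    ‖((g₁ * g₂ : Matrix.specialUnitaryGroup n ℂ) : Matrix n n ℂ) - ((h₁ * h₂ : Matrix.specialUnitaryGroup n ℂ) : Matrix n n ℂ)‖ ≤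
      ‖(g₁ : Matrix n n ℂ) - (h₁ : Matrix n n ℂ)‖ + ‖(g₂ : Matrix n n ℂ) - (h₂ : Matrix n n ℂ)‖ := by
  simp only [Submonoid.coe_mul]
  have hid : (g₁ : Matrix n n ℂ) * (g₂ : Matrix n n ℂ) - (h₁ : Matrix n n ℂ) * (h₂ : Matrix n n ℂ) =
      ((g₁ : Matrix n n ℂ) - (h₁ : Matrix n n ℂ)) * (g₂ : Matrix n n ℂ) + (h₁ : Matrix n n ℂ) * ((g₂ : Matrix n n ℂ) - (h₂ : Matrix n n ℂ)) := by
    noncomm_ring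
  rw [hid]
  refine (norm_add_le _ _).trans (add_le_add ?_ ?_)
  · exact (norm_mul_le _ _).trans (by rw [norm_coe_su, mul_one])
  · exact (norm_mul_le _ _).trans (by rw [norm_coe_su, one_mul])

/-- `‖g⁻¹ − h⁻¹‖ = ‖g − h‖` for special unitaries. [folklore] -/
private theorem norm_coe_inv_sub_inv (g h : Matrix.specialUnitaryGroup n ℂ) :
    ‖((g⁻¹ : Matrix.specialUnitaryGroup n ℂ) : Matrix n n ℂ) - ((h⁻¹ : Matrix.specialUnitaryGroup n ℂ) : Matrix n n ℂ)‖ =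
      ‖(g : Matrix n n ℂ) - (h : Matrix n n ℂ)‖ := by
  rw [coe_inv_su, coe_inv_su, ← star_sub, norm_star]

/-- In the matrix model `dist1 g = ‖g − 1‖`. [folklore] -/
private theorem dist1_eq [Nonempty n] (g : Matrix.specialUnitaryGroup n ℂ) : dist1 g = ‖(g : Matrix n n ℂ) - 1‖ := rfl

/-- `|dist1 g − dist1 h| ≤ ‖g − h‖`. [folklore] -/
private theorem abs_dist1_sub_dist1_le [Nonempty n] (g h : Matrix.specialUnitaryGroup n ℂ) :
    |dist1 g - dist1 h| ≤ ‖(g : Matrix n n ℂ) - (h : Matrix n n ℂ)‖ := by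
  rw [dist1_eq, dist1_eq]
  have := abs_norm_sub_norm_le ((g : Matrix n n ℂ) - 1) ((h : Matrix n n ℂ) - 1)
  rwa [sub_sub_sub_cancel_right] at this

end Matrices

/-! ## §1 The curvature gradient is 10-Lipschitz in the bonds -/

section Gradient

variable {P : Params} {s : ℕ}

/-- **THE CURVATURE GRADIENT MOVES BY AT MOST TEN BOND DISPLACEMENTS**: if every bond variable of `U′` is within `ε` of that of `U`
(`SU(2)`, operator norm), then every backward covariant derivative of every plaquette field of `U′` is within `10ε` of that of `U` —
in the reading `(D^{1*}_{ν}F_{κκ′})(z + e_ν) = V(z,ν)⁻¹V(∂p_{κκ′}(z))V(z,ν) − V(∂p_{κκ′}(z + e_ν))` (two plaquettes, `4ε` each, one transport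
bond twice). [cite: Balaban1985RegularSpaces, (1.1) p.76] -/
theorem norm_covDerivT_plaqFT_sub_le {U U' : GaugeField P s (Matrix.specialUnitaryGroup (Fin 2) ℂ)} {ε : ℝ}
    (hε : ∀ b, ‖((U' b : Matrix.specialUnitaryGroup (Fin 2) ℂ) : Matrix (Fin 2) (Fin 2) ℂ) - (U b : Matrix (Fin 2) (Fin 2) ℂ)‖ ≤ ε)
    (x : Site P s) (ν κ κ' : Fin P.d) (hκ : κ ≠ κ') :
    ‖covDerivT 1 (unitsField (toUField U')) ν (plaqFT (unitsField (toUField U')) κ κ') x -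
        covDerivT 1 (unitsField (toUField U)) ν (plaqFT (unitsField (toUField U)) κ κ') x‖ ≤ 10 * ε := by
  have hP : ∀ p : Plaq P s, ‖((GaugeField.plaqHol U' p : Matrix.specialUnitaryGroup (Fin 2) ℂ) : Matrix (Fin 2) (Fin 2) ℂ) -
      ((GaugeField.plaqHol U p : Matrix.specialUnitaryGroup (Fin 2) ℂ) : Matrix (Fin 2) (Fin 2) ℂ)‖ ≤ 4 * ε := norm_plaqHol_sub_plaqHol_le hε
  -- the conjugated term is `ε + 4ε + ε`-close
  have hconj : ∀ (u u' X X' : Matrix.specialUnitaryGroup (Fin 2) ℂ),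
      ‖(u' : Matrix (Fin 2) (Fin 2) ℂ) - (u : Matrix (Fin 2) (Fin 2) ℂ)‖ ≤ ε →
      ‖(X' : Matrix (Fin 2) (Fin 2) ℂ) - (X : Matrix (Fin 2) (Fin 2) ℂ)‖ ≤ 4 * ε →
        ‖((u'⁻¹ * X' * u' : Matrix.specialUnitaryGroup (Fin 2) ℂ) : Matrix (Fin 2) (Fin 2) ℂ) -
            ((u⁻¹ * X * u : Matrix.specialUnitaryGroup (Fin 2) ℂ) : Matrix (Fin 2) (Fin 2) ℂ)‖ ≤ 6 * ε := by
    intro u u' X X' hu hX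
    have h1 := norm_coe_mul_sub_mul_le (u'⁻¹ * X') u' (u⁻¹ * X) u
    have h2 := norm_coe_mul_sub_mul_le u'⁻¹ X' u⁻¹ X
    rw [norm_coe_inv_sub_inv] at h2
    linarith
  rw [← shift_unshift' x ν]
  rcases lt_or_gt_of_ne hκ with hlt | hgt
  · rw [covDerivT_plaqFT_shift_eq U' ν hlt, covDerivT_plaqFT_shift_eq U ν hlt, sub_sub_sub_comm]
    refine (norm_sub_le _ _).trans ?_
    have h1 := hconj (U ⟨x.unshift ν, ν⟩) (U' ⟨x.unshift ν, ν⟩) _ _ (hε _) (hP ⟨x.unshift ν, κ, κ', hlt⟩)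
    have h2 := hP ⟨(x.unshift ν).shift ν, κ, κ', hlt⟩
    linarith
  · rw [covDerivT_plaqFT_shift_eq_inv U' ν hgt, covDerivT_plaqFT_shift_eq_inv U ν hgt, sub_sub_sub_comm]
    refine (norm_sub_le _ _).trans ?_
    have hX : ‖(((GaugeField.plaqHol U' ⟨x.unshift ν, κ', κ, hgt⟩)⁻¹ : Matrix.specialUnitaryGroup (Fin 2) ℂ) : Matrix (Fin 2) (Fin 2) ℂ) -
        (((GaugeField.plaqHol U ⟨x.unshift ν, κ', κ, hgt⟩)⁻¹ : Matrix.specialUnitaryGroup (Fin 2) ℂ) : Matrix (Fin 2) (Fin 2) ℂ)‖ ≤ 4 * ε := by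
      rw [norm_coe_inv_sub_inv]; exact hP _
    have h1 := hconj (U ⟨x.unshift ν, ν⟩) (U' ⟨x.unshift ν, ν⟩) _ _ (hε _) hX
    have h2 : ‖(((GaugeField.plaqHol U' ⟨(x.unshift ν).shift ν, κ', κ, hgt⟩)⁻¹ : Matrix.specialUnitaryGroup (Fin 2) ℂ) : Matrix (Fin 2) (Fin 2) ℂ) -
        (((GaugeField.plaqHol U ⟨(x.unshift ν).shift ν, κ', κ, hgt⟩)⁻¹ : Matrix.specialUnitaryGroup (Fin 2) ℂ) : Matrix (Fin 2) (Fin 2) ℂ)‖ ≤ 4 * ε := by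
      rw [norm_coe_inv_sub_inv]; exact hP _
    linarith

end Gradient

/-! ## §2 The Wilson action is Lipschitz in the bonds on small fields -/

section Action

variable (F : T3Family)

/-- The number of plaquettes of the finest lattice of run `K` is `24·L^{3(m+K)}`. [cite: Balaban1985UV3, (1)-(3) p.256] -/
theorem card_plaq_eq (K : ℕ) : (Fintype.card (Plaq (F.P K) 0) : ℝ) = 24 * (F.L : ℝ) ^ (3 * (F.m + K)) := by
  rw [B10Eq41TorusHistories.card_plaq_three rfl, Site.card_site]
  show ((3 * (2 * F.L ^ (F.m + K - 0)) ^ 3 : ℕ) : ℝ) = _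
  rw [show F.m + K - 0 = F.m + K by omega]
  push_cast
  ring

/-- **THE WILSON ACTION IS LIPSCHITZ IN THE BONDS ON SMALL FIELDS** (`SU(2)`, `1 − Re tr W = ½|W − 1|²`): if `U` has plaquettes `< t`
(`t ≥ 0`) and every bond of `U′` is within `ε ≥ 0` of that of `U`, then `|A(U′) − A(U)| ≤ 24L^{3(m+K)}·2ε(2t + 4ε)` on the finest lattice of
run `K`. [cite: Balaban1987RG1, (0.2) p.252] -/
theorem abs_wilsonAction4_sub_le (K : ℕ) {t ε : ℝ} (hε0 : 0 ≤ ε)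
    {U U' : GaugeField (F.P K) 0 (Matrix.specialUnitaryGroup (Fin 2) ℂ)} (hU : PlaqSmall t U)
    (hε : ∀ b, ‖((U' b : Matrix.specialUnitaryGroup (Fin 2) ℂ) : Matrix (Fin 2) (Fin 2) ℂ) - (U b : Matrix (Fin 2) (Fin 2) ℂ)‖ ≤ ε) :
    |wilsonAction4 U' - wilsonAction4 U| ≤ 24 * (F.L : ℝ) ^ (3 * (F.m + K)) * (2 * ε * (2 * t + 4 * ε)) := by
  unfold wilsonAction4 wilsonAction
  simp only [one_mul, one_sub_reTr_eq_half_dist1_sq_su2]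
  rw [← Finset.sum_sub_distrib]
  refine (Finset.abs_sum_le_sum_abs _ _).trans ?_
  calc ∑ p : Plaq (F.P K) 0, |1 / 2 * dist1 (GaugeField.plaqHol U' p) ^ 2 - 1 / 2 * dist1 (GaugeField.plaqHol U p) ^ 2|
      ≤ ∑ _p : Plaq (F.P K) 0, 2 * ε * (2 * t + 4 * ε) := Finset.sum_le_sum fun p _ => by
        have hd := hU p
        have hd0 := GaugeGroup.dist1_nonneg (GaugeField.plaqHol U p)
        have hd0' := GaugeGroup.dist1_nonneg (GaugeField.plaqHol U' p)
        have hdiff : |dist1 (GaugeField.plaqHol U' p) - dist1 (GaugeField.plaqHol U p)| ≤ 4 * ε :=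
          (abs_dist1_sub_dist1_le _ _).trans (norm_plaqHol_sub_plaqHol_le hε p)
        have hd' : dist1 (GaugeField.plaqHol U' p) ≤ t + 4 * ε := by
          have := (abs_le.mp hdiff).2; linarith
        rw [← mul_sub, abs_mul, abs_of_pos (by norm_num : (0 : ℝ) < 1 / 2), sq_sub_sq, abs_mul]
        have h1 : |dist1 (GaugeField.plaqHol U' p) + dist1 (GaugeField.plaqHol U p)| ≤ 2 * t + 4 * ε := by
          rw [abs_of_nonneg (by linarith)]; linarith
        calc 1 / 2 * (|dist1 (GaugeField.plaqHol U' p) + dist1 (GaugeField.plaqHol U p)| *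
              |dist1 (GaugeField.plaqHol U' p) - dist1 (GaugeField.plaqHol U p)|)
            ≤ 1 / 2 * ((2 * t + 4 * ε) * (4 * ε)) :=
              mul_le_mul_of_nonneg_left (mul_le_mul h1 hdiff (abs_nonneg _) (by linarith)) (by norm_num)
          _ = 2 * ε * (2 * t + 4 * ε) := by ring
    _ = 24 * (F.L : ℝ) ^ (3 * (F.m + K)) * (2 * ε * (2 * t + 4 * ε)) := by
        rw [Finset.sum_const, Finset.card_univ, nsmul_eq_mul, card_plaq_eq]

end Action

/-! ## §3 The reduction: `SmoothLiftAt` from an approximate smooth lift -/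

section Reduction

/-- The defect polynomial of the correction step: with `η = C₃(b + a²)`, `t = C₁(a + b)`, `0 ≤ a ≤ 1`, `0 ≤ b`,
`2Cη(2t + 4Cη) ≤ 16CC₃(C₁ + CC₃)·(b² + ab + a³)` (every monomial of `(b + a²)(a + b)` and `(b + a²)²` lies in `b² + ab + a³`). [folklore] -/
theorem defect_poly_le {a b C C₁ C₃ : ℝ} (ha : 0 ≤ a) (hb : 0 ≤ b) (ha1 : a ≤ 1) (hC : 0 ≤ C) (hC₁ : 0 ≤ C₁) (hC₃ : 0 ≤ C₃) :
    2 * (C * (C₃ * (b + a ^ 2))) * (2 * (C₁ * (a + b)) + 4 * (C * (C₃ * (b + a ^ 2)))) ≤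
      16 * C * C₃ * (C₁ + C * C₃) * (b ^ 2 + a * b + a ^ 3) := by
  set X : ℝ := b ^ 2 + a * b + a ^ 3 with hX_def
  have hX0 : 0 ≤ X := by positivity
  have ha2b : a ^ 2 * b ≤ a * b := by nlinarith [mul_nonneg ha hb]
  have ha4 : a ^ 4 ≤ a ^ 3 := by nlinarith [pow_nonneg ha 3]
  have hk1 : (b + a ^ 2) * (a + b) ≤ 2 * X := by rw [hX_def]; nlinarith [mul_nonneg ha hb, pow_nonneg ha 3]
  have hk2 : (b + a ^ 2) * (b + a ^ 2) ≤ 2 * X := by rw [hX_def]; nlinarith [mul_nonneg ha hb, pow_nonneg ha 3]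
  have hCC₃ : 0 ≤ C * C₃ := mul_nonneg hC hC₃
  have e1 : 2 * (C * (C₃ * (b + a ^ 2))) * (2 * (C₁ * (a + b)) + 4 * (C * (C₃ * (b + a ^ 2)))) =
      4 * (C * C₃ * C₁) * ((b + a ^ 2) * (a + b)) + 8 * (C * C₃) ^ 2 * ((b + a ^ 2) * (b + a ^ 2)) := by ring
  rw [e1]
  have h1 : 4 * (C * C₃ * C₁) * ((b + a ^ 2) * (a + b)) ≤ 4 * (C * C₃ * C₁) * (2 * X) :=
    mul_le_mul_of_nonneg_left hk1 (by positivity)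
  have h2 : 8 * (C * C₃) ^ 2 * ((b + a ^ 2) * (b + a ^ 2)) ≤ 8 * (C * C₃) ^ 2 * (2 * X) :=
    mul_le_mul_of_nonneg_left hk2 (by positivity)
  have h3 : 0 ≤ C * C₃ * C₁ * X := by positivity
  nlinarith

/-- **EXACTNESS IS FREE: `SmoothLiftAt` FROM AN APPROXIMATE SMOOTH LIFT.**  If for every member of the family with block size `L`, every run
`K` and all `0 ≤ a, b ≤ c` every field `U` with plaquettes `< a` and curvature gradients `≤ b` has an APPROXIMATE lift `U″` — (i′)
`‖(D_{K,K+1}U″)(c′) − U(c′)‖ ≤ C₃(b + a²)` for every coarse bond, (ii) plaquettes `< C₁(a+b)`, (iii) gradients `≤ C₁(b + a²)`, (iv) `L·A(U″) ≤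
A(U) + C₂(b² + ab + a³)L^{3(m+K)}` (`C₁ > 0`, `C₂, C₃ ≥ 0`, `c > 0`) — then `SmoothLiftAt L C₁′ C₂′ c′` with `C₁′ = C₁ + 10·C·C₃`, `C₂′ = C₂ + 384·L⁴·C·C₃·(C₁ + C·C₃)`, `c′ = min c (min 1 (t₀/(2C₁ +
2C·C₃ + 1)))`, where `t₀, C` are the exact corrector's constants at block size `L` (`BlockAvgCorrector.exists_corrector_T3`): the
approximate lift `U″` is `C₁(a+b)`-small with `C₁(a+b) + C·C₃(b + a²) ≤ t₀`, so the corrector returns `U′` with `D_{K,K+1}U′ = U` exactly,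
bonds moved by `≤ C·C₃(b + a²)`; plaquettes, gradients and action move accordingly (§1–§2). [cite: Balaban1985Averaging, Prop. 3 (122)-(125) p.36] -/
theorem smoothLiftAt_of_approx (L : ℕ) {C₁ C₂ C₃ c : ℝ} (hC₁ : 0 < C₁) (hC₂ : 0 ≤ C₂) (hC₃ : 0 ≤ C₃) (hc : 0 < c)
    (h : ∀ F : T3Family, F.L = L → ∀ (K : ℕ) (a b : ℝ), 0 ≤ a → a ≤ c → 0 ≤ b → b ≤ c →
      ∀ U : GaugeField (F.P K) 0 (Matrix.specialUnitaryGroup (Fin 2) ℂ), PlaqSmall a U →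
        (∀ (x : Site (F.P K) 0) (ν κ κ' : Fin (F.P K).d), κ ≠ κ' →
          ‖covDerivT 1 (unitsField (toUField U)) ν (plaqFT (unitsField (toUField U)) κ κ') x‖ ≤ b) →
          ∃ U'' : GaugeField (F.P (K + 1)) 0 (Matrix.specialUnitaryGroup (Fin 2) ℂ),
            (∀ c' : PBond (F.P K) 0,
              ‖((descendTo F ℰp K (K + 1) (Nat.le_succ K) U'' c' : Matrix.specialUnitaryGroup (Fin 2) ℂ) : Matrix (Fin 2) (Fin 2) ℂ) -
                  (U c' : Matrix (Fin 2) (Fin 2) ℂ)‖ ≤ C₃ * (b + a ^ 2)) ∧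
            PlaqSmall (C₁ * (a + b)) U'' ∧
            (∀ (x : Site (F.P (K + 1)) 0) (ν κ κ' : Fin (F.P (K + 1)).d), κ ≠ κ' →
              ‖covDerivT 1 (unitsField (toUField U'')) ν (plaqFT (unitsField (toUField U'')) κ κ') x‖ ≤ C₁ * (b + a ^ 2)) ∧
            (F.L : ℝ) * wilsonAction4 U'' ≤ wilsonAction4 U + C₂ * (b ^ 2 + a * b + a ^ 3) * (F.L : ℝ) ^ (3 * (F.m + K))) :
    ∃ C₁' C₂' c' : ℝ, 0 < C₁' ∧ 0 ≤ C₂' ∧ 0 < c' ∧ SmoothLiftAt L C₁' C₂' c' := by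
  obtain ⟨t₀, C, ht₀, hC, hcorr⟩ := exists_corrector_T3 L
  set c' : ℝ := min c (min 1 (t₀ / (2 * C₁ + 2 * C * C₃ + 1))) with hc'_def
  have hden : 0 < 2 * C₁ + 2 * C * C₃ + 1 := by positivity
  have hc'c : c' ≤ c := min_le_left _ _
  have hc'1 : c' ≤ 1 := (min_le_right _ _).trans (min_le_left _ _)
  have hc't : c' ≤ t₀ / (2 * C₁ + 2 * C * C₃ + 1) := (min_le_right _ _).trans (min_le_right _ _)
  have hc'pos : 0 < c' := lt_min hc (lt_min one_pos (div_pos ht₀ hden))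
  refine ⟨C₁ + 10 * C * C₃, C₂ + 384 * (L : ℝ) ^ 4 * C * C₃ * (C₁ + C * C₃), c', by positivity, by positivity, hc'pos, ?_⟩
  intro F hFL K a b ha hac hb hbc U hU hgrad
  have hL1 : (1 : ℝ) ≤ F.L := by exact_mod_cast F.hL.2.le
  have hac1 : a ≤ 1 := hac.trans hc'1
  have ha2 : a ^ 2 ≤ a := by nlinarith
  -- the approximate lift
  obtain ⟨U'', happ, hsmall, hgrad'', hact⟩ := h F hFL K a b ha (hac.trans hc'c) hb (hbc.trans hc'c) U hU hgrad
  -- the corrector's hypotheses at level `0 → 1` of run `K + 1`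
  set t : ℝ := C₁ * (a + b) with ht_def
  set η : ℝ := C₃ * (b + a ^ 2) with hη_def
  have ht0 : 0 ≤ t := by positivity
  have hη0 : 0 ≤ η := by positivity
  have htη : t + C * η ≤ t₀ := by
    have h1 : t + C * η ≤ (2 * C₁ + 2 * C * C₃ + 1) * c' := by
      have hab : a + b ≤ 2 * c' := by linarith
      have hba : b + a ^ 2 ≤ 2 * c' := by linarith
      rw [ht_def, hη_def]
      nlinarith [mul_le_mul_of_nonneg_left hab hC₁.le, mul_le_mul_of_nonneg_left hba (mul_nonneg hC hC₃), hc'pos.le]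
    have h2 : (2 * C₁ + 2 * C * C₃ + 1) * c' ≤ t₀ := by
      have := mul_le_mul_of_nonneg_left hc't hden.le
      rwa [mul_div_cancel₀ _ hden.ne'] at this
    linarith
  -- the target, read at level 1 of run `K + 1`
  set hsd := F.sitesPerDir_eq (m := F.m) (K := K) (j := 0) (m' := F.m) (K' := K + 1) (j' := 1) (by omega) with hsd_def
  set V : GaugeField (F.P (K + 1)) (0 + 1) (Matrix.specialUnitaryGroup (Fin 2) ℂ) := fieldShift hsd.symm U with hV_def
  have hdesc : ∀ W : GaugeField (F.P (K + 1)) 0 (Matrix.specialUnitaryGroup (Fin 2) ℂ),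
      descendTo F ℰp K (K + 1) (Nat.le_succ K) W = fieldShift hsd (avgFun (P := F.P (K + 1)) (j := 0) ℰp W) := by
    intro W; rw [descendTo_succ, blockAvg_avg]; rfl
  have hV : ∀ c₁ : PBond (F.P (K + 1)) (0 + 1),
      ‖((V c₁ : Matrix.specialUnitaryGroup (Fin 2) ℂ) : Matrix (Fin 2) (Fin 2) ℂ) -
        ((avgFun ℰp U'' c₁ : Matrix.specialUnitaryGroup (Fin 2) ℂ) : Matrix (Fin 2) (Fin 2) ℂ)‖ ≤ η := by
    intro c₁
    have h1 := happ (bondShift hsd.symm c₁)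
    rw [hdesc, fieldShift_apply, bondShift_bondShift, bondShift_refl] at h1
    rw [hV_def, fieldShift_apply, norm_sub_rev]
    exact h1
  have hj : 0 + 1 ≤ F.m + (K + 1) := by omega
  obtain ⟨U', hU'V, -, hU'b, hU'small⟩ := hcorr F hFL (K + 1) 0 hj t η ht0 hη0 htη U'' hsmall V hV
  refine ⟨U', ?_, ?_, ?_, ?_⟩
  · -- (i) exactness
    rw [hdesc, hU'V, hV_def, fieldShift_symm_fieldShift]
  · -- (ii) plaquettes: `t + 4Cη ≤ (C₁ + 10CC₃)(a + b)`
    intro p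
    refine (hU'small p).trans_le ?_
    rw [ht_def, hη_def]
    have : b + a ^ 2 ≤ a + b := by linarith
    nlinarith [mul_nonneg hC hC₃, mul_nonneg (mul_nonneg hC hC₃) (by linarith : (0 : ℝ) ≤ a + b)]
  · -- (iii) gradients: `C₁(b + a²) + 10Cη`
    intro x ν κ κ' hκ
    have h1 := norm_covDerivT_plaqFT_sub_le hU'b x ν κ κ' hκ
    have h2 := hgrad'' x ν κ κ' hκ
    have h3 : ‖covDerivT 1 (unitsField (toUField U')) ν (plaqFT (unitsField (toUField U')) κ κ') x‖ ≤
        C₁ * (b + a ^ 2) + 10 * (C * (C₃ * (b + a ^ 2))) := by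
      have := norm_le_insert' (covDerivT 1 (unitsField (toUField U')) ν (plaqFT (unitsField (toUField U')) κ κ') x)
        (covDerivT 1 (unitsField (toUField U'')) ν (plaqFT (unitsField (toUField U'')) κ κ') x)
      rw [hη_def] at h1
      linarith
    calc ‖covDerivT 1 (unitsField (toUField U')) ν (plaqFT (unitsField (toUField U')) κ κ') x‖
        ≤ C₁ * (b + a ^ 2) + 10 * (C * (C₃ * (b + a ^ 2))) := h3
      _ = (C₁ + 10 * C * C₃) * (b + a ^ 2) := by ring
  · -- (iv) action: `L·A(U′) ≤ L·A(U″) + L·|A(U′) − A(U″)|`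
    have hΔ := abs_wilsonAction4_sub_le F (K + 1) (by positivity : (0 : ℝ) ≤ C * η) hsmall hU'b
    have hL0 : (0 : ℝ) ≤ F.L := by linarith
    set D : ℝ := 2 * (C * η) * (2 * t + 4 * (C * η)) with hD_def
    set X : ℝ := b ^ 2 + a * b + a ^ 3 with hX_def
    have hX0 : 0 ≤ X := by positivity
    have hD : D ≤ 16 * C * C₃ * (C₁ + C * C₃) * X := by
      rw [hD_def, ht_def, hη_def]
      exact defect_poly_le ha hb hac1 hC hC₁.le hC₃
    have hA' : wilsonAction4 U' ≤ wilsonAction4 U'' + 24 * (F.L : ℝ) ^ (3 * (F.m + (K + 1))) * D := by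
      have := (abs_le.mp hΔ).2; linarith
    have hpow : (F.L : ℝ) * (24 * (F.L : ℝ) ^ (3 * (F.m + (K + 1)))) = 24 * (F.L : ℝ) ^ 4 * (F.L : ℝ) ^ (3 * (F.m + K)) := by
      rw [show 3 * (F.m + (K + 1)) = 3 * (F.m + K) + 3 by ring, pow_add]; ring
    have h1 : (F.L : ℝ) * wilsonAction4 U' ≤ (F.L : ℝ) * wilsonAction4 U'' + 24 * (F.L : ℝ) ^ 4 * (F.L : ℝ) ^ (3 * (F.m + K)) * D := by
      have := mul_le_mul_of_nonneg_left hA' hL0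
      rw [mul_add, ← mul_assoc, hpow] at this
      exact this
    have h2 : 24 * (F.L : ℝ) ^ 4 * (F.L : ℝ) ^ (3 * (F.m + K)) * D ≤
        24 * (F.L : ℝ) ^ 4 * (F.L : ℝ) ^ (3 * (F.m + K)) * (16 * C * C₃ * (C₁ + C * C₃) * X) :=
      mul_le_mul_of_nonneg_left hD (by positivity)
    subst hFL
    calc (F.L : ℝ) * wilsonAction4 U' ≤ (F.L : ℝ) * wilsonAction4 U'' + 24 * (F.L : ℝ) ^ 4 * (F.L : ℝ) ^ (3 * (F.m + K)) * D := h1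
      _ ≤ (wilsonAction4 U + C₂ * X * (F.L : ℝ) ^ (3 * (F.m + K))) +
          24 * (F.L : ℝ) ^ 4 * (F.L : ℝ) ^ (3 * (F.m + K)) * (16 * C * C₃ * (C₁ + C * C₃) * X) := add_le_add hact h2
      _ = wilsonAction4 U + (C₂ + 384 * (F.L : ℝ) ^ 4 * C * C₃ * (C₁ + C * C₃)) * X * (F.L : ℝ) ^ (3 * (F.m + K)) := by ring

end Reduction

end Summit.QuantumFields.YangMills.Theorems.SmoothLiftApprox

end
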